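import Literature.Geometry.Kaehler.NearlyHolomorphicCycleSupportLocalHomology
import Literature.Geometry.Kaehler.AnalyticSetLocalHomology
import HarnessLib

/-!
# The classes supported on a nearly holomorphic cycle support form a line

Topic `Literature/Geometry/Kaehler`. The topological half of the threshold lemma of the Hodge
summit's route *HolomorphicityRate* (item `ThresholdForcesHodgeType`: "`S ∖ Sg` connected and nearly
complex ⟹ `H²ᵖ_S(X^an) = ℂ · [S]` (Thom isomorphism off an analytic set of codimension `≥ p + 1`)"):
for a nearly holomorphic cycle support `(S, Sg)` of codimension `p ≥ 1`
(`Literature.Geometry.Kaehler.IsNearlyHolomorphicCycleSupport`: `S ⊇ Sg` closed, `S ∖ Sg` connected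
and a real `C¹` submanifold of codimension `2p` near each of its points, `Sg` inside a closed
analytic set all of whose regular points have codimension `≥ p + 1`) in a second countable complex
manifold `M` charted on a finite-dimensional complex space:

* `IsNearlyHolomorphicCycleSupport.exists_ker_map_compl_le_span` — **there is `τ ∈ H²ᵖ(M; ℂ)` with
  `ker (H²ᵖ(M; ℂ) → H²ᵖ(M ∖ S; ℂ)) ≤ ℂ · τ`**;
* `IsNearlyHolomorphicCycleSupport.finrank_ker_map_compl_le_one` — hence that kernel has dimension
  `≤ 1`.

Proof, assembling the tree: in `U = M ∖ Sg` the good part is closed, connected and locally flat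
(`NearlyHolomorphicCycleSupportFlat`), so the critical local homology `H_{2p}(U | S ∖ Sg; ℂ)` is a
line (`NearlyHolomorphicCycleSupportLocalHomology`, from
`SingularHomology.exists_forall_mem_span_localHomologyOfSet_of_locallyFlat`) and the classes of
`H²ᵖ(U)` dying on `U ∖ S = M ∖ S` lie on a line
(`SingularHomology.exists_ker_cohomologyMap_le_span_of_localHomologyOfSet`); the restriction
`H²ᵖ(M) → H²ᵖ(U)` is one-to-one, dually to `H_{2p}(U) ↠ H_{2p}(M)`, i.e. `H_{2p}(M | Sg) = 0`, which
holds because `Sg` lies in an analytic set of codimension `≥ p + 1` (`AnalyticSetLocalHomology`,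
`IsAnalyticSet.isZero_localHomologyOfSet_of_subset`, from the analytic semipurity
`AnalyticSetSemipurity`). Theorems only; no named facts (Cartan–Whitney and the structure of
analytic sets are theorems of the tree).

## References

* C. Voisin, *Hodge Theory and Complex Algebraic Geometry I* (2002), §11.1.2 Lemma 11.13. [VoisinHodgeI2002]
* J. R. King, *The currents defined by analytic varieties*, Acta Math. 127 (1971). [King1971]
* A. Hatcher, *Algebraic Topology* (2002), §3.1 Thm. 3.2, §3.3 Lemma 3.27. [HatcherAT2002]
-/

noncomputable section

open scoped Manifold ContDiff Topology
open Set Function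

namespace Literature.Geometry.Kaehler

/-! ### The classes supported on a nearly holomorphic cycle support form a line -/

section Line

open CategoryTheory CategoryTheory.Limits
open Literature.AlgebraicTopology.SingularHomology TopologicalSpace Bundle

variable {E : Type} [NormedAddCommGroup E] [NormedSpace ℂ E] [FiniteDimensional ℂ E]
  {M : Type} [TopologicalSpace M] [ChartedSpace E M] [IsManifold 𝓘(ℂ, E) 1 M]
  [SecondCountableTopology M]

omit [FiniteDimensional ℂ E] [IsManifold 𝓘(ℂ, E) 1 M] [ChartedSpace E M] [SecondCountableTopology M] in
/-- Over a field, if `f_* : Hₙ(A; F) → Hₙ(B; F)` is onto then `f^* : Hⁿ(B; F) → Hⁿ(A; F)` is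
one-to-one (`⟨f^* a, c⟩ = ⟨a, f_* c⟩` and the Kronecker map is one-to-one over a field; same
statement as `HodgeTheory.injective_cohomologyMap_of_surjective_homologyMap`, re-derived to keep
the import cone topological). [cite: HatcherAT2002, §3.1 Thm. 3.2] -/
theorem injective_cohomologyMap_of_surjective_homologyMap' (F : Type) [Field F] {A B : Type}
    [TopologicalSpace A] [TopologicalSpace B] (f : C(A, B)) (n : ℕ)
    (hf : Function.Surjective (singularHomology.map F F f n)) :
    Function.Injective (singularCohomology.map F F f n) := by
  refine (injective_iff_map_eq_zero _).2 fun a ha ↦ kroneckerPairing_injective_of_field F B n ?_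
  rw [map_zero]
  refine LinearMap.ext fun c ↦ ?_
  obtain ⟨c', rfl⟩ := hf c
  rw [← kroneckerPairing_map, ha, map_zero, LinearMap.zero_apply, LinearMap.zero_apply]

omit [FiniteDimensional ℂ E] [IsManifold 𝓘(ℂ, E) 1 M] [ChartedSpace E M] [SecondCountableTopology M]
  [TopologicalSpace M] [NormedAddCommGroup E] [NormedSpace ℂ E] in
/-- If a subspace `K` is carried by a one-to-one linear map into a line `F · τ`, then `K` lies in a
line (same statement as `HodgeTheory.exists_le_span_singleton_of_injective`, re-derived).
[folklore] -/
theorem exists_le_span_singleton_of_injective' {F : Type*} [Field F] {V W : Type*} [AddCommGroup V]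
    [Module F V] [AddCommGroup W] [Module F W] (f : V →ₗ[F] W) (hf : Function.Injective f)
    (K : Submodule F V) (τ : W) (h : ∀ x ∈ K, f x ∈ Submodule.span F ({τ} : Set W)) :
    ∃ v : V, K ≤ Submodule.span F {v} := by
  by_cases hK : K = ⊥
  · exact ⟨0, by rw [hK]; exact bot_le⟩
  obtain ⟨x₀, hx₀K, hx₀⟩ := (Submodule.ne_bot_iff _).1 hK
  refine ⟨x₀, fun x hx ↦ ?_⟩
  obtain ⟨a, ha⟩ := Submodule.mem_span_singleton.1 (h x₀ hx₀K)
  obtain ⟨b, hb⟩ := Submodule.mem_span_singleton.1 (h x hx)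
  have ha0 : a ≠ 0 := by
    rintro rfl
    rw [zero_smul, eq_comm] at ha
    exact hx₀ (hf (by rw [ha, map_zero]))
  refine Submodule.mem_span_singleton.2 ⟨b / a, hf ?_⟩
  rw [map_smul, ← ha, smul_smul, div_mul_cancel₀ b ha0, hb]

/-- **The classes supported on a nearly holomorphic cycle support form a line** ("Thom isomorphism
off an analytic set of codimension `≥ p + 1`", the first step of the threshold lemma
`ThresholdForcesHodgeType` of route *HolomorphicityRate*, Hodge summit): for a nearly holomorphic
cycle support `(S, Sg)` of codimension `p ≥ 1` in a second countable complex manifold `M`, there is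
a class `τ ∈ H²ᵖ(M; ℂ)` such that every class of `H²ᵖ(M; ℂ)` restricting to `0` on `M ∖ S` is a
multiple of `τ`. Proof: in the open `U = M ∖ Sg` the good part `S ∖ Sg` is closed, connected and
locally flat of real codimension `2p`, so `H_{2p}(U | S ∖ Sg; ℂ)` is a line
(`exists_forall_mem_span_localHomologyOfSet`) and the classes of `H²ᵖ(U)` dying on `U ∖ S = M ∖ S`
lie on a line (`exists_ker_cohomologyMap_le_span_of_localHomologyOfSet`); the restriction
`H²ᵖ(M) → H²ᵖ(U)` is one-to-one because `H_{2p}(U) → H_{2p}(M)` is onto, i.e.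
`H_{2p}(M | Sg) = 0` — `Sg` lies in an analytic set with regular points of codimension `≥ p + 1`
(`IsAnalyticSet.isZero_localHomologyOfSet_of_subset`). [cite: VoisinHodgeI2002, §11.1.2 Lemma 11.13]
[cite: King1971] [cite: HatcherAT2002, §3.3 Lemma 3.27] -/
theorem IsNearlyHolomorphicCycleSupport.exists_ker_map_compl_le_span
    {g : RiemannianMetric (fun x : M ↦ TangentSpace 𝓘(ℝ, E) x)} {p : ℕ} {t : ℝ} {S Sg : Set M}
    (h : IsNearlyHolomorphicCycleSupport g p t S Sg) (hp : 1 ≤ p) :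
    ∃ τ : singularCohomology ℂ ℂ M (2 * p),
      LinearMap.ker (singularCohomology.map ℂ ℂ (subsetIncl Sᶜ) (2 * p)).hom ≤
        Submodule.span ℂ {τ} := by
  -- the bad set lies in an analytic set `T` of codimension `≥ p + 1`
  obtain ⟨T, hSgT, hT, hTcodim⟩ := h.exists_isAnalyticSet
  have hc₀ : ∀ z c, z ∈ T → IsRegularPointOfCodim 𝓘(ℂ, E) T c z → p + 1 ≤ c :=
    fun z c hz hc ↦ hTcodim z ⟨hz, c, hc⟩ c hc
  -- the line in `H²ᵖ(U)`, `U = M ∖ Sg` (read on the subtype `↥Sgᶜ`)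
  have hθ : ∃ θ : localHomologyOfSet ℂ ℂ (↥(Sgᶜ : Set M)) (Subtype.val ⁻¹' S) (2 * p),
      ∀ c, c ∈ Submodule.span ℂ ({θ} : Set _) :=
    h.exists_forall_mem_span_localHomologyOfSet ℂ hp
  obtain ⟨τU, hτU⟩ := exists_ker_cohomologyMap_le_span_of_localHomologyOfSet ℂ
    (Subtype.val ⁻¹' S : Set ↥(Sgᶜ : Set M)) (2 * p) hθ
  -- `H_{2p}(M | Sg) = 0`, hence `H_{2p}(M ∖ Sg) → H_{2p}(M)` is onto and `H²ᵖ(M) → H²ᵖ(M ∖ Sg)` is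
  -- one-to-one
  have hzero : IsZero (localHomologyOfSet ℂ ℂ M Sg (2 * p)) :=
    hT.isZero_localHomologyOfSet_of_subset ℂ ℂ hc₀ h.isClosed_bad hSgT (by omega) (by omega)
  have hsurj : Function.Surjective (singularHomology.map ℂ ℂ (subsetIncl (Sgᶜ : Set M)) (2 * p)) := by
    have hex := relativeSingularHomology.exact_map_ofAbsolute ℂ ℂ (X := M) Sgᶜ (2 * p)
    have hepi := hex.epi_f (hzero.eq_of_tgt _ _)
    exact (ModuleCat.epi_iff_surjective _).1 hepi
  have hinj : Function.Injective (singularCohomology.map ℂ ℂ (subsetIncl (Sgᶜ : Set M)) (2 * p)) :=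
    injective_cohomologyMap_of_surjective_homologyMap' ℂ _ _ hsurj
  -- `M ∖ S` read in `U`: `{x : U | x ∉ S} ≃ₜ M ∖ S`
  let gH : ↥(Subtype.val ⁻¹' S : Set ↥(Sgᶜ : Set M))ᶜ ≃ₜ ↥(Sᶜ : Set M) :=
    { toFun := fun x ↦ ⟨x.1.1, x.2⟩
      invFun := fun y ↦ ⟨⟨y.1, fun hy ↦ y.2 (h.subset hy)⟩, y.2⟩
      left_inv := fun _ ↦ rfl
      right_inv := fun _ ↦ rfl
      continuous_toFun := (continuous_subtype_val.comp continuous_subtype_val).subtype_mk _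
      continuous_invFun := (continuous_subtype_val.subtype_mk _).subtype_mk _ }
  have hcomp : (subsetIncl (Sgᶜ : Set M)).comp
      ((subsetIncl (Subtype.val ⁻¹' S : Set ↥(Sgᶜ : Set M))ᶜ).comp
        (gH.symm : C(↥(Sᶜ : Set M), ↥(Subtype.val ⁻¹' S : Set ↥(Sgᶜ : Set M))ᶜ))) =
      subsetIncl (Sᶜ : Set M) :=
    ContinuousMap.ext fun _ ↦ rfl
  have hfac : singularCohomology.map ℂ ℂ (subsetIncl (Sᶜ : Set M)) (2 * p) =
      singularCohomology.map ℂ ℂ (subsetIncl (Sgᶜ : Set M)) (2 * p) ≫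
        singularCohomology.map ℂ ℂ (subsetIncl (Subtype.val ⁻¹' S : Set ↥(Sgᶜ : Set M))ᶜ) (2 * p) ≫
          singularCohomology.map ℂ ℂ
            (gH.symm : C(↥(Sᶜ : Set M), ↥(Subtype.val ⁻¹' S : Set ↥(Sgᶜ : Set M))ᶜ)) (2 * p) := by
    rw [← hcomp, singularCohomology.map_comp, singularCohomology.map_comp]
  have hginj : Function.Injective (singularCohomology.map ℂ ℂ
      (gH.symm : C(↥(Sᶜ : Set M), ↥(Subtype.val ⁻¹' S : Set ↥(Sgᶜ : Set M))ᶜ)) (2 * p)) :=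
    ((forget (ModuleCat ℂ)).mapIso (singularCohomology.mapIso ℂ ℂ gH.symm (2 * p))).toEquiv.injective
  -- pull the line back along the one-to-one restriction
  refine exists_le_span_singleton_of_injective'
    (singularCohomology.map ℂ ℂ (subsetIncl (Sgᶜ : Set M)) (2 * p)).hom hinj _ τU fun x hx ↦ hτU ?_
  rw [LinearMap.mem_ker]
  apply hginj
  rw [map_zero]
  have hx' : singularCohomology.map ℂ ℂ (subsetIncl (Sᶜ : Set M)) (2 * p) x = 0 := LinearMap.mem_ker.1 hx
  rw [hfac, ModuleCat.comp_apply, ModuleCat.comp_apply] at hx'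
  exact hx'

/-- Hence **`dim_ℂ ker (H²ᵖ(M; ℂ) → H²ᵖ(M ∖ S; ℂ)) ≤ 1`** for a nearly holomorphic cycle support `S`
of codimension `p ≥ 1`. [cite: VoisinHodgeI2002, §11.1.2 Lemma 11.13] -/
theorem IsNearlyHolomorphicCycleSupport.finrank_ker_map_compl_le_one
    {g : RiemannianMetric (fun x : M ↦ TangentSpace 𝓘(ℝ, E) x)} {p : ℕ} {t : ℝ} {S Sg : Set M}
    (h : IsNearlyHolomorphicCycleSupport g p t S Sg) (hp : 1 ≤ p) :
    Module.finrank ℂ (LinearMap.ker (singularCohomology.map ℂ ℂ (subsetIncl Sᶜ) (2 * p)).hom) ≤ 1 := by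
  obtain ⟨τ, hτ⟩ := h.exists_ker_map_compl_le_span hp
  refine (Submodule.finrank_mono hτ).trans ?_
  simpa using finrank_span_le_card ({τ} : Set (singularCohomology ℂ ℂ M (2 * p)))

end Line

end Literature.Geometry.Kaehler

end
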